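import Literature.MathematicalPhysics.QuantumFieldTheory.Balaban1983to89.B8Prop6CubeMemberScalarBdryBetaPrinted
import Literature.MathematicalPhysics.QuantumFieldTheory.Balaban1983to89.B8Eq191FlatStencils
import Literature.MathematicalPhysics.QuantumFieldTheory.Balaban1983to89.B8Eq191FlatLettersCubeMember

/-!
# `Balaban1983to89.B8Ineq159FlatShellModeVacuity` — KERNEL CERTIFICATE: the β-edition SCALAR FLAT (1.59) CLAUSE OF THEOREM 4's FRAME
# (`SC2`, two lines, [Balaban1985RegularSpaces] (1.59) p. 86 at `U₀ = 1`) is FALSE at truncation `m = 1` of EVERY cube member `{□_j}` of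
# (1.131) with `k ≥ 1`, for EVERY `B₀`, `B_∂` — an INTERIOR SHELL GAUGE MODE `φ = ∂λ` on `∂□₁`; hence the `SC2` hypothesis of
# `B8Prop6CubeMemberScalarBdryBetaPrinted.gaugedBoundB8_cubeMember_scalar_bdryβ_printed` (and of every theorem carrying it) is UNINHABITED at
# every `Node00.CubeB8` cube, and those theorems are vacuous AS TYPED.  Located root cause: the constraint-bond class `B8CubeMemberZd.cubeLamB`
# contains NO crossing bond (its first conjunct «fine box ⊂ □_j» empties its two crossing disjuncts), so print's (1.31) contours ∕ [B6] (2.3)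
# bonds of `Λ_j` sticking out of `□_j^{(j)}` are missing from the averaging datum `|B₁|β`

statement-level skeleton of published theorems with citation tags; proofs where landed; nothing here is a claim about the
Yang–Mills mass gap

`[Balaban1985RegularSpaces]` ("B8", CMP **99** (1985) 75–102) (1.59) p. 86, (1.31) p. 82 («All sites of the contours Γ_{b₋,x} belong to Λ_{j−1}»),
(1.38) p. 82, Thm 4 p. 88, Prop. 6 p. 99, (1.131) p. 99; [B6] = `[Balaban1984PropagatorsII]` (CMP **96** (1984) 223–250) (2.3) p. 224 («Λ_j = Ω_j^{(j)} ∖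
Ω_{j+1}^{(j)} … for the sets of sites and the sets of bonds», bonds of `Ω` = «at least one end-point of b belongs to Ω»), (2.6)–(2.7) p. 224; [4] =
`[Balaban1985BackgroundPropagators]` Thm 3.3 p. 399.  PDF held: `paper:balaban1985-cmp99-regular-spaces-gauge-fixing`, `paper:balaban1984-cmp96-propagators-rt-ii`
(p. 224 re-read this session, `p0002.txt`).

CITATION HEADER (lean-in-tree rule).  Cell `pub-ymgap` (YM Track A, HUMAN RULING D-0062), DAG node N05 = [B8], seat `pub-ymgap-dag-n05-c` (g11;
director-ym R134, row s1 «first missing estimate»).  WHY: after g10's 𝒢-bound the ONLY per-cube hypotheses of the flat p6 letter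
(`B8Prop6CubeMemberScalarBdryBetaPrinted`, p569918, dag-n05-e g9) are the two SCALAR flat (1.59) β clauses `SC4`∕`SC2` (memo `HOME/pub-ymgap-dag-n05-e/
SCALAR-BETA-CLAUSES.md`); sizing them for a transplant from lit-balaban's torus-with-level-0 chain (G-F3′-L0) produced the ZERO MODE below.  This is the third
located defect of the (1.59) socket at a finite `Ω₀` after the corner defect (`B8Ineq159FlatCornerDefect`, repaired by the Bdry edition) and the `∂□₀`
pure-gauge mode (`B9SupplySockB9P3ZdAtBoundaryMode`, repaired by the β edition's `CrossB □₀`): the β edition repairs level `0` only; the shells `∂□_j`,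
`j ≥ 1`, stay open because `cubeLamB` has no crossing bonds.

THE MATHEMATICS (all kernel-checked; `d ≥ 2`, `L ≥ 1`, `η > 0`, cube datum `(a, M, ρ, k)` with `ρ ≥ 1`, `k ≥ 1`; every `B₀, B_∂ ∈ ℝ`).
* §1 `cubeLamB_ends_inBox_sq`: every datum bond `c ∈ cubeLamB … m j` has BOTH ends in `□_j^{(j)}` (from its first conjunct alone, `B8CubeMemberZd.
  ends_inBox_sq_of_bondBox_subset`'s mechanism); `mem_cubeLamB_iff_inner`: for `j ≤ m ≤ k` the two CROSSING disjuncts of `cubeLamB` are EMPTY (a crossing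
  end has its sub-blocks in `Λ_{j−1} = □_{j−1}^{(j−1)} ∖ □_j^{(j−1)}`, i.e. lies outside `□_j^{(j)}`) — `cubeLamB … m j` = the INNER bonds of `cubeLamS … m j`.
* §2 `exists_shellMode` (linear algebra, no analysis): there is `λ : ℤᵈ → ℂ`, `λ ≠ 0`, supported in `□₁`, with EQUAL `L`-BLOCK SUMS over the blocks of
  `□₁^{(1)}` and with `Δ^η_1(𝟙_{□₀}·D^{η*}_1 ∂λ)` CONSTANT ON EVERY `L`-BLOCK of `□₁` — `N − 1` homogeneous `ℝ`-linear conditions on the `N = |□₁|`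
  values (an endomorphism of `ℂ^{□₁}` with an identically vanishing coordinate is not surjective, hence not injective: `LinearMap.injective_iff_surjective`).
* §3 `false_of_shellMode`: for such `λ`, `φ := ∂λ = (D^η_{1,κ}λ)_κ` satisfies the two hypotheses of `SC2` at `m = 1` — (1.38) in multiplier form
  (`IsLandau138 L 1 η □₀ (cubeLamS … 1) 1 φ`: the level-0 multiplier is FREE on `Λ₀ = □₀ ∖ □₁`, the level-1 multiplier carries the block constants;
  `B8Eq191FlatStencils.QT_flat_apply`) and the support clause — while EVERY right-hand datum vanishes: `J = D^{η*}D^η ∂λ ≡ 0` (`plaqCovDeriv` of a flat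
  gradient), `Q₀(iηφ) = iηφ = 0` on the level-0 datum bonds (both ends in `□₀ ∖ □₁`) and on `CrossB □₀` (collar `ρ ≥ 1`), `L·Q₁(iηφ)(c) = i·L^{−d}(Σ_{B(c₊)}λ −
  Σ_{B(c₋)}λ) = 0` on the level-1 datum bonds (both ends in `□₁^{(1)}` by §1; `linQcov_one_left`, `asum_seg_natCast`, telescoping), `φ = 0` on the outer
  layer; so the right side is `B₀·(0 + 0 + B_∂·0) = 0`, whereas `|φ|₍₋₁₎ ≥ η·|φ(b₀)| > 0` at a bond `b₀` where `λ` jumps (`weight_mul_norm_le_msup`).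
* §4 ★ `not_flat159β_two_cubeMember_one` (`m = 1`), ★ `not_flat159β_two_cubeMember` (the `∀ m ≤ k` form carried by the flat p6 letter), ★★
  `sc2_uninhabited_cubeB8`: at every `c : Node00.CubeB8 d L K Ω` (`L ≥ 1`) the `SC2` hypothesis of `gaugedBoundB8_cubeMember_scalar_bdryβ_printed` is
  uninhabited (`c.one_le_k`, `c.L_le_ρ`).
EXACT CROSS-CHECK outside Lean (`HOME/pub-ymgap-dag-n05-c/lean/g11/zeromode_check.py`, rational arithmetic, `d = 2`, `L = 2`, `k = m = 1`, `M = ρ = 2`):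
`|□₀| = 256`, `|□₁| = 144`, 143 equations, rank 143, kernel dimension 1, all data `0`, `max|φ| > 0`.

REPAIR (for the owners of the index laws ∕ the β files; nothing of theirs is restated here).  Print's datum class at level `j ≥ 1` is [B6] (2.3) ∕ (1.31):
ALL `j`-bonds with at least one end in `Λ_j` and no end inside `□_{j+1}^{(j)}` — lit-balaban p21's `B6SectADomainsV1.Domains.LamBond` — INCLUDING the
bonds sticking out of `□_j^{(j)}` (fine box inside `□_{j−1}`, not `□_j`); with them the shell modes die (`Q_j(∂λ)(c) = Q′_jλ(c₊) − Q′_jλ(c₋)` forces the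
block constants of consecutive shells to agree, down to `λ = 0` on `Λ₀`), and the clause becomes print's (1.59) at `U₀ = 1` = [4] Thm 3.3 at `U = 1`, i.e.
exactly what a transplant of the torus-with-level-0 (1.59) (`Constr` = `LamBond`) delivers.  `B8LeafModelZd.ZdIdx.hbox` («box ⊂ Ω_j») is what forces the
empty crossing class at nested members.

HONEST SCOPE.  A typing defect located and certified; nothing of Bałaban's analysis is refuted (print is consistent: its `|B₁|` ranges over (1.31)'s
contours); `SC4` (four lines at `m = k`) coincides with `SC2` at `k = 1` in its first two lines and has the analogous `k`-parameter shell-mode family for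
`k ≥ 2` (same count; not certified here); count-neutral; N05 NOT discharged; one finite `T⁴` programme at fixed `ε`, Bałaban as printed; nothing continuum ∕
ℝ⁴ ∕ OS ∕ mass-gap ∕ Clay.  No `sorry`, no `def`, no `instance`, no `notation`.  Unit `pub-ymgap-dag-n05-c` (g11), 2026-08-27.
-/

noncomputable section

namespace Literature.MathematicalPhysics.QuantumFieldTheory.Balaban1983to89.B8Ineq159FlatShellModeVacuity

open B7Prop1Explicit B7Prop2Explicit B7Prop1Local
open B7Prop4GeneralLevels (linCovIter linCovIter_zero linCovIter_succ)
open B7Prop3GeneralLinear (linQcov_one_left)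
open B7Prop3Flat (linQ)
open B8Ineq132 (covDerivFwd BondTouches Under)
open B8Eq140Level (SideTouches sideTouches_of_bondTouches)
open B8Eq143PlaqExpansion (pdiv)
open B8Eq146AExpansion (iEta plaqCovDeriv plaqCovDeriv_eq_covDerivFwd)
open B8Eq155JBound (Jcur wsup wsup_le wsup_nonneg)
open B8ScaledSupNorm (bondNorm msup weight msup_le msup_nonneg Bdd weight_mul_norm_le_msup bondNorm_zero)
open B8Eq138LandauZd (IsLandau138 covLap covDivB QT)
open B8Eq131Cubes (cube sqLo sqHi inLo inHi mem_cube_iff cube_succ_subset)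
open B8Eq131CubesAdmissible (cubeFam cubeFam_false_zero cubeFam_of_pos smul_mem_cube_iff smul_mem_cube_succ_iff
  add_mem_cube_of_mem_succ)
open B8CubeMemberZd (cubeLam cubeLamS cubeLamB mem_cubeLam_zero_iff cubeLamS_of_lt cubeLamS_self smul_mem_bondBox
  smul_add_mem_bondBox)
open B9SupplySockB9P3ZdBeta (CrossB)
open B8Eq191FlatStencils (covDerivFwd_flat_apply covDeriv_flat_apply covLap_flat_apply QT_flat_apply)
open B8Eq191FlatLettersCubeMember (inBox_finite under_iff_blockMap_eq under_smul_self)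
open Literature.MathematicalPhysics.QuantumLattice (blockMap blockMap_one)

export B7Prop1Explicit (Site)

variable {d : ℕ}

/-! ## §1 The located defect: every datum bond of `cubeLamB` at level `j` has both ends in `□_j^{(j)}` -/

/-- ★ **THE LOCATED DEFECT, part 1: every datum bond of `cubeLamB … m j` has BOTH ends in `□_j^{(j)}`** (`j ≤ k`) — from the class's first conjunct
«the fine box `Bʲ(c₋) ∪ Bʲ(c₊)` lies in `□_j`» alone; print's crossing contours (1.31) ∕ the [B6] (2.3) bonds sticking out of `□_j^{(j)}` are therefore absent.
[cite: Balaban1985RegularSpaces, (1.31) p.82, (1.131) p.99; Balaban1984PropagatorsII, (2.3) p.224] -/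
theorem cubeLamB_ends_inBox_sq {L : ℕ} (hL : 1 ≤ L) (a : Site d) (M ρ : ℕ) {k m j : ℕ} (hj : j ≤ k)
    {c : Site d × Fin d} (hc : c ∈ cubeLamB L a M ρ k m j) :
    InBox (sqLo L a ρ k j) (sqHi L a M ρ k j) c.1 ∧ InBox (sqLo L a ρ k j) (sqHi L a M ρ k j) (c.1 + e c.2) := by
  have hbox := hc.1
  rw [B8Eq131CubesAdmissible.cubeFam_false_of_le L a M ρ hj] at hbox
  exact ⟨(smul_mem_cube_iff hL a M ρ k j c.1).1 (hbox _ (smul_mem_bondBox hL j c.1 c.2)),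
    (smul_mem_cube_iff hL a M ρ k j (c.1 + e c.2)).1 (hbox _ (smul_add_mem_bondBox hL j c.1 c.2))⟩

/-- ★ **THE LOCATED DEFECT, part 2: the two CROSSING disjuncts of `cubeLamB` are EMPTY** (`j ≤ m ≤ k`, `L ≥ 1`): a crossing end has its `L` sub-blocks in
`Λ_{j−1} = cubeLamS … m (j−1) = □_{j−1}^{(j−1)} ∖ □_j^{(j−1)}`, i.e. lies outside `□_j^{(j)}`, contradicting part 1; so `cubeLamB … m j` IS the class of INNER
bonds of `cubeLamS … m j` with box in `□_j`. [cite: Balaban1985RegularSpaces, (1.31) p.82, (1.131) p.99; Balaban1984PropagatorsII, (2.3) p.224] -/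
theorem mem_cubeLamB_iff_inner {L : ℕ} (hL : 1 ≤ L) (a : Site d) (M ρ : ℕ) {k m j : ℕ} (hjm : j ≤ m) (hmk : m ≤ k)
    (c : Site d × Fin d) :
    c ∈ cubeLamB L a M ρ k m j ↔
      (∀ x, InBox (loK L j c.1) (bondHiK L j c.1 c.2) x → x ∈ cubeFam false L a M ρ k j) ∧
        c.1 ∈ cubeLamS L a M ρ k m j ∧ c.1 + e c.2 ∈ cubeLamS L a M ρ k m j := by
  constructor
  · intro hc
    refine ⟨hc.1, ?_⟩
    have hends := cubeLamB_ends_inBox_sq hL a M ρ (hjm.trans hmk) hc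
    rcases hc.2 with h | ⟨j', hjj', hsub, h2⟩ | ⟨j', hjj', h1, hsub⟩
    · exact h
    · exfalso
      -- the lowest sub-block `L • c₋` of `c₋` would lie in `Λ_{j'} = □_{j'}^{(j')} ∖ □_{j'+1}^{(j')}`, but `c₋ ∈ □_{j'+1}^{(j'+1)}`
      subst hjj'
      have hlt : j' < m := by omega
      have hx := hsub ((L : ℤ) • c.1) (le_refl _) (by
        intro i
        simp only [Pi.add_apply, B8Thm2LogB.blockTop, Pi.smul_apply, smul_eq_mul]
        have : (1 : ℤ) ≤ (L : ℤ) := by exact_mod_cast hL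
        linarith)
      rw [cubeLamS_of_lt L a M ρ k hlt] at hx
      have hx2 := hx.2 (by omega)
      apply hx2
      have h3 : ((L : ℤ) ^ j') • ((L : ℤ) • c.1) ∈ cube L a M ρ k (j' + 1) := by
        rw [smul_smul, ← pow_succ]
        exact (smul_mem_cube_iff hL a M ρ k (j' + 1) c.1).2 hends.1
      exact (smul_mem_cube_succ_iff hL a M ρ (by omega) _).1 h3
    · exfalso
      subst hjj'
      have hlt : j' < m := by omega
      have hx := hsub ((L : ℤ) • (c.1 + e c.2)) (le_refl _) (by
        intro i
        simp only [Pi.add_apply, B8Thm2LogB.blockTop, Pi.smul_apply, smul_eq_mul]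
        have : (1 : ℤ) ≤ (L : ℤ) := by exact_mod_cast hL
        linarith)
      rw [cubeLamS_of_lt L a M ρ k hlt] at hx
      have hx2 := hx.2 (by omega)
      apply hx2
      have h3 : ((L : ℤ) ^ j') • ((L : ℤ) • (c.1 + e c.2)) ∈ cube L a M ρ k (j' + 1) := by
        rw [smul_smul, ← pow_succ]
        exact (smul_mem_cube_iff hL a M ρ k (j' + 1) (c.1 + e c.2)).2 hends.2
      exact (smul_mem_cube_succ_iff hL a M ρ (by omega) _).1 h3
  · intro h
    exact ⟨h.1, Or.inl h.2⟩


/-! ## §2 Existence of the shell mode (linear algebra: `N − 1` homogeneous conditions on `N` unknowns) -/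

/-- `gs L n = Σ_{i ≤ n} Lⁱ ≥ 1`. [folklore] [cite: Balaban1985RegularSpaces, p.98 (display before (1.128))] -/
theorem one_le_gs (L n : ℕ) : 1 ≤ B8Eq131Cubes.gs L n := by
  cases n with
  | zero => simp
  | succ n => rw [B8Eq131Cubes.gs_succ]; omega

/-- `□₁^{(1)}` is non-empty: its lower corner belongs to it (`ρ ≥ 1`). [cite: Balaban1985RegularSpaces, p.98, (1.131) p.99] -/
theorem sqLo_inBox_one (L : ℕ) (a : Site d) (M : ℕ) {ρ : ℕ} (hρ : 1 ≤ ρ) (k : ℕ) :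
    InBox (sqLo L a ρ k 1) (sqHi L a M ρ k 1) (sqLo L a ρ k 1) := by
  intro i
  refine ⟨le_rfl, ?_⟩
  have hg : (1 : ℤ) ≤ (B8Eq131Cubes.gs L (k - 1) : ℤ) := by exact_mod_cast one_le_gs L (k - 1)
  have hρ' : (1 : ℤ) ≤ (ρ : ℤ) := by exact_mod_cast hρ
  have hLM : (0 : ℤ) ≤ (L : ℤ) ^ (k - 1) * (M : ℤ) := by positivity
  simp only [sqLo, sqHi, B8Eq131Cubes.bLo, B8Eq131Cubes.bHi]
  push_cast
  nlinarith

/-- `blockMap L (L • z) = z`: the `L`-block of a block corner. [folklore] [cite: Balaban1985RegularSpaces, p.79 («x₀ ∈ Bʲ(x_j)»)] -/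
theorem blockMap_smul_self {L : ℕ} (hL : 1 ≤ L) (z : Site d) : blockMap (L ^ 1) (((L : ℤ) ^ 1) • z) = z :=
  (under_iff_blockMap_eq hL 1 z _).1 (under_smul_self hL 1 z)

/-- A real-linear endomorphism of `ℂ^ι` (`ι` finite) with an identically vanishing coordinate is not surjective, hence not injective: it has a non-zero kernel vector. [folklore] -/
private theorem exists_ne_zero_of_coord_zero {ι : Type*} [Fintype ι] [DecidableEq ι]
    (Φ : (ι → ℂ) →ₗ[ℝ] (ι → ℂ)) (i₀ : ι) (h0 : ∀ v, Φ v i₀ = 0) : ∃ v, v ≠ 0 ∧ Φ v = 0 := by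
  have hns : ¬ Function.Surjective Φ := by
    intro hs
    obtain ⟨v, hv⟩ := hs (fun i => if i = i₀ then (1 : ℂ) else 0)
    have := congrFun hv i₀
    rw [h0 v] at this
    simp at this
  have hni : ¬ Function.Injective Φ := fun hi => hns (LinearMap.injective_iff_surjective.mp hi)
  rw [injective_iff_map_eq_zero] at hni
  push Not at hni
  obtain ⟨v, hv, hne⟩ := hni
  exact ⟨v, hne, hv⟩

open Classical in
/-- ★★ **EXISTENCE OF THE SHELL MODE** (linear algebra): for every cube datum with `ρ ≥ 1` there is `λ : ℤᵈ → ℂ`, `λ ≠ 0`, bounded, supported in `□₁`,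
with equal `L`-block sums over the blocks of `□₁^{(1)}` and with `Δ^η_1(𝟙_{□₀}·D^{η*}_1∂λ)` constant on every `L`-block of `□₁` — `N − 1` homogeneous
`ℝ`-linear conditions on `N = |□₁|` complex unknowns (`exists_ne_zero_of_coord_zero`; the stencils are the flat readings of `B8Eq191FlatStencils`).
[cite: Balaban1985RegularSpaces, (1.38) p.82, (1.59) p.86, (1.131) p.99; Balaban1984PropagatorsII, (2.6)–(2.7) p.224] -/
theorem exists_shellMode {L : ℕ} (hL : 1 ≤ L) (η : ℝ) (a : Site d) (M : ℕ) {ρ : ℕ} (hρ : 1 ≤ ρ) (k : ℕ) :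
    ∃ lam : Site d → ℂ,
      (∀ x, x ∉ cube L a M ρ k 1 → lam x = 0) ∧ (∃ x, lam x ≠ 0) ∧ (∃ Λ : ℝ, ∀ x, ‖lam x‖ ≤ Λ) ∧
      (∀ z z', InBox (sqLo L a ρ k 1) (sqHi L a M ρ k 1) z → InBox (sqLo L a ρ k 1) (sqHi L a M ρ k 1) z' →
        ∑ r : Fin d → Fin L, lam ((L : ℤ) • z + boxVec L r) = ∑ r : Fin d → Fin L, lam ((L : ℤ) • z' + boxVec L r)) ∧
      (∀ x ∈ cube L a M ρ k 1, ∀ x' ∈ cube L a M ρ k 1, blockMap (L ^ 1) x = blockMap (L ^ 1) x' →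
        covLap η (1 : Site d → Fin d → ℂˣ) ((cube L a M ρ k 0).indicator
            (covDivB η (1 : Site d → Fin d → ℂˣ) (fun y κ => covDerivFwd η (1 : Site d → Fin d → ℂˣ) κ lam y))) x =
        covLap η (1 : Site d → Fin d → ℂˣ) ((cube L a M ρ k 0).indicator
            (covDivB η (1 : Site d → Fin d → ℂˣ) (fun y κ => covDerivFwd η (1 : Site d → Fin d → ℂˣ) κ lam y))) x') := by
  -- the unknowns: functions on the finite set `S₁ = □₁`
  set S₁ : Finset (Site d) := (inBox_finite (B8Ineq130.tlo L (sqLo L a ρ k 1) 1) (B8Ineq130.thi L (sqHi L a M ρ k 1) 1)).toFinset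
    with hS₁def
  have hS : ∀ x, x ∈ S₁ ↔ x ∈ cube L a M ρ k 1 := fun x => by
    rw [hS₁def, Set.Finite.mem_toFinset]; rfl
  -- evaluation functionals of the zero extension, and the stencils of the clause as `ℝ`-linear functionals
  let E : Site d → ((↥S₁ → ℂ) →ₗ[ℝ] ℂ) := fun y => if h : y ∈ S₁ then LinearMap.proj (⟨y, h⟩ : ↥S₁) else 0
  let G : Site d → Fin d → ((↥S₁ → ℂ) →ₗ[ℝ] ℂ) := fun y κ => η⁻¹ • (E (y + e κ) - E y)
  let Dv : Site d → ((↥S₁ → ℂ) →ₗ[ℝ] ℂ) := fun x => ∑ μ : Fin d, η⁻¹ • (G (x - e μ) μ - G x μ)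
  let Ig : Site d → ((↥S₁ → ℂ) →ₗ[ℝ] ℂ) := fun x => if x ∈ cube L a M ρ k 0 then Dv x else 0
  let Hh : Site d → ((↥S₁ → ℂ) →ₗ[ℝ] ℂ) := fun x =>
    ∑ μ : Fin d, (η ^ 2)⁻¹ • ((2 : ℝ) • Ig x - Ig (x + e μ) - Ig (x - e μ))
  let Sb : Site d → ((↥S₁ → ℂ) →ₗ[ℝ] ℂ) := fun z => ∑ r : Fin d → Fin L, E ((L : ℤ) • z + boxVec L r)
  let base : Site d → Site d := fun x => ((L : ℤ) ^ 1) • blockMap (L ^ 1) x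
  set z₀ : Site d := sqLo L a ρ k 1 with hz₀
  let Φ : (↥S₁ → ℂ) →ₗ[ℝ] (↥S₁ → ℂ) := LinearMap.pi fun x : ↥S₁ =>
    (Hh x.1 - Hh (base x.1)) + (if x.1 = base x.1 then Sb (blockMap (L ^ 1) x.1) - Sb z₀ else 0)
  -- dictionary between the functionals and the tree's stencils
  have hE : ∀ (v : ↥S₁ → ℂ) (y : Site d), y ∉ cube L a M ρ k 1 → E y v = 0 := by
    intro v y hy
    have hy' : y ∉ S₁ := fun h => hy ((hS y).1 h)
    simp only [E, dif_neg hy', LinearMap.zero_apply]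
  have hG : ∀ (v : ↥S₁ → ℂ) (y : Site d) (κ : Fin d),
      G y κ v = covDerivFwd η (1 : Site d → Fin d → ℂˣ) κ (fun w => E w v) y := by
    intro v y κ
    simp only [G, covDerivFwd_flat_apply, LinearMap.smul_apply, LinearMap.sub_apply]
  have hDv : ∀ (v : ↥S₁ → ℂ) (x : Site d),
      Dv x v = covDivB η (1 : Site d → Fin d → ℂˣ) (fun y κ => covDerivFwd η (1 : Site d → Fin d → ℂˣ) κ (fun w => E w v) y) x := by
    intro v x
    simp only [Dv, covDivB, covDeriv_flat_apply, LinearMap.coe_sum, Finset.sum_apply, LinearMap.smul_apply,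
      LinearMap.sub_apply, hG]
  have hIg : ∀ (v : ↥S₁ → ℂ) (x : Site d),
      Ig x v = (cube L a M ρ k 0).indicator
        (covDivB η (1 : Site d → Fin d → ℂˣ) (fun y κ => covDerivFwd η (1 : Site d → Fin d → ℂˣ) κ (fun w => E w v) y)) x := by
    intro v x
    by_cases hx : x ∈ cube L a M ρ k 0
    · simp only [Ig, if_pos hx, Set.indicator_of_mem hx, hDv]
    · simp only [Ig, if_neg hx, Set.indicator_of_notMem hx, LinearMap.zero_apply]
  have hH : ∀ (v : ↥S₁ → ℂ) (x : Site d),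
      Hh x v = covLap η (1 : Site d → Fin d → ℂˣ) ((cube L a M ρ k 0).indicator
        (covDivB η (1 : Site d → Fin d → ℂˣ) (fun y κ => covDerivFwd η (1 : Site d → Fin d → ℂˣ) κ (fun w => E w v) y))) x := by
    intro v x
    simp only [Hh, covLap_flat_apply, LinearMap.coe_sum, Finset.sum_apply, LinearMap.smul_apply,
      LinearMap.sub_apply, hIg]
  have hSb : ∀ (v : ↥S₁ → ℂ) (z : Site d), Sb z v = ∑ r : Fin d → Fin L, E ((L : ℤ) • z + boxVec L r) v := by
    intro v z
    simp only [Sb, LinearMap.coe_sum, Finset.sum_apply]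
  -- block facts
  have hbase_mem : ∀ x ∈ cube L a M ρ k 1, base x ∈ cube L a M ρ k 1 ∧ blockMap (L ^ 1) (base x) = blockMap (L ^ 1) x ∧
      InBox (sqLo L a ρ k 1) (sqHi L a M ρ k 1) (blockMap (L ^ 1) x) := by
    intro x hx
    obtain ⟨z, hz, hu⟩ := (mem_cube_iff hL).1 hx
    have hzx : blockMap (L ^ 1) x = z := (under_iff_blockMap_eq hL 1 z x).1 hu
    refine ⟨?_, ?_, ?_⟩
    · show ((L : ℤ) ^ 1) • blockMap (L ^ 1) x ∈ cube L a M ρ k 1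
      rw [hzx]; exact (smul_mem_cube_iff hL a M ρ k 1 z).2 hz
    · show blockMap (L ^ 1) (((L : ℤ) ^ 1) • blockMap (L ^ 1) x) = blockMap (L ^ 1) x
      rw [hzx]; exact blockMap_smul_self hL z
    · rw [hzx]; exact hz
  have hbase_of_sq : ∀ z, InBox (sqLo L a ρ k 1) (sqHi L a M ρ k 1) z →
      ((L : ℤ) ^ 1) • z ∈ cube L a M ρ k 1 ∧ base (((L : ℤ) ^ 1) • z) = ((L : ℤ) ^ 1) • z ∧
        blockMap (L ^ 1) (((L : ℤ) ^ 1) • z) = z := by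
    intro z hz
    refine ⟨(smul_mem_cube_iff hL a M ρ k 1 z).2 hz, ?_, blockMap_smul_self hL z⟩
    show ((L : ℤ) ^ 1) • blockMap (L ^ 1) (((L : ℤ) ^ 1) • z) = ((L : ℤ) ^ 1) • z
    rw [blockMap_smul_self hL z]
  -- the coordinate at `x₀ = L • z₀` vanishes identically
  obtain ⟨hx₀mem, hx₀base, hx₀blk⟩ := hbase_of_sq z₀ (sqLo_inBox_one L a M hρ k)
  have hx₀S : ((L : ℤ) ^ 1) • z₀ ∈ S₁ := (hS _).2 hx₀mem
  have hΦ₀ : ∀ v, Φ v ⟨((L : ℤ) ^ 1) • z₀, hx₀S⟩ = 0 := by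
    intro v
    simp only [Φ, LinearMap.pi_apply, LinearMap.add_apply, LinearMap.sub_apply]
    rw [if_pos hx₀base.symm, hx₀base, hx₀blk, LinearMap.sub_apply, sub_self, sub_self, add_zero]
  obtain ⟨v, hv, hΦv⟩ := exists_ne_zero_of_coord_zero Φ ⟨((L : ℤ) ^ 1) • z₀, hx₀S⟩ hΦ₀
  -- decode the kernel equations
  have hcoord : ∀ x : ↥S₁, (Hh x.1 v - Hh (base x.1) v) +
      (if x.1 = base x.1 then Sb (blockMap (L ^ 1) x.1) - Sb z₀ else 0) v = 0 := by
    intro x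
    have := congrFun hΦv x
    simpa only [Φ, LinearMap.pi_apply, LinearMap.add_apply, LinearMap.sub_apply, Pi.zero_apply] using this
  have hH_base : ∀ x ∈ cube L a M ρ k 1, Hh x v = Hh (base x) v := by
    intro x hx
    have hxS : x ∈ S₁ := (hS x).2 hx
    by_cases hb : x = base x
    · rw [← hb]
    · have := hcoord ⟨x, hxS⟩
      rw [if_neg hb, LinearMap.zero_apply, add_zero] at this
      exact sub_eq_zero.1 this
  have hSb_eq : ∀ z, InBox (sqLo L a ρ k 1) (sqHi L a M ρ k 1) z → Sb z v = Sb z₀ v := by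
    intro z hz
    obtain ⟨hmem, hb, hblk⟩ := hbase_of_sq z hz
    have := hcoord ⟨((L : ℤ) ^ 1) • z, (hS _).2 hmem⟩
    rw [if_pos hb.symm, hb, sub_self, zero_add, LinearMap.sub_apply, hblk] at this
    exact sub_eq_zero.1 this
  -- the witness
  refine ⟨fun w => E w v, fun x hx => hE v x hx, ?_, ⟨‖v‖, fun x => ?_⟩, ?_, ?_⟩
  · -- non-trivial
    have : ∃ x : ↥S₁, v x ≠ 0 := by
      by_contra h
      push Not at h
      exact hv (funext h)
    obtain ⟨x, hx⟩ := this
    refine ⟨x.1, ?_⟩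
    simp only [E, dif_pos x.2, LinearMap.coe_proj, Function.eval, Subtype.coe_eta]
    exact hx
  · -- bounded
    by_cases hx : x ∈ S₁
    · simp only [E, dif_pos hx, LinearMap.coe_proj, Function.eval]
      exact norm_le_pi_norm v ⟨x, hx⟩
    · simp only [E, dif_neg hx, LinearMap.zero_apply, norm_zero]
      exact norm_nonneg _
  · -- equal block sums
    intro z z' hz hz'
    have h1 := hSb_eq z hz
    have h2 := hSb_eq z' hz'
    rw [hSb, hSb] at h1 h2
    rw [h1, h2]
  · -- the Landau quantity is block-constant on `□₁`
    intro x hx x' hx' hxx'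
    rw [← hH, ← hH, hH_base x hx, hH_base x' hx']
    show Hh (((L : ℤ) ^ 1) • blockMap (L ^ 1) x) v = Hh (((L : ℤ) ^ 1) • blockMap (L ^ 1) x') v
    rw [hxx']


/-! ## §3 The shell mode violates the two-line β clause at `m = 1` -/

/-- ★★ **THE SHELL MODE VIOLATES `SC2` AT `m = 1`**: for `λ` as in `exists_shellMode`, `φ := ∂λ` satisfies (1.38) in multiplier form (level-0 multiplier
free on `Λ₀ = □₀ ∖ □₁`, level-1 multiplier = the block constants) and the support clause, every right-hand datum of the two-line β clause vanishes
(`J = D^{η*}D^η∂λ ≡ 0`; level-0 data on bonds with both ends in `□₀ ∖ □₁`, on `CrossB □₀` and on the outer layer are `0`; level-1 data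
`i·L^{−d}(Σ_{B(c₊)}λ − Σ_{B(c₋)}λ) = 0` by the equal block sums, both ends of `c` lying in `□₁^{(1)}` by `cubeLamB_ends_inBox_sq`), and the left side is
`≥ η·|φ(b₀)| > 0` at a bond where `λ` jumps: the clause fails for EVERY `B₀`, `B_∂`. [cite: Balaban1985RegularSpaces, (1.59) p.86, (1.38) p.82, (1.31) p.82, (1.131) p.99; Balaban1985BackgroundPropagators, Thm 3.3 p.399] -/
theorem false_of_shellMode (hd2 : 2 ≤ d) {L : ℕ} (hL : 1 ≤ L) {η : ℝ} (hη : 0 < η) (a : Site d) (M : ℕ)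
    {ρ : ℕ} (hρ : 1 ≤ ρ) {k : ℕ} (hk : 1 ≤ k) (B₀ Bbd : ℝ) {lam : Site d → ℂ}
    (hsupp : ∀ x, x ∉ cube L a M ρ k 1 → lam x = 0) (hne : ∃ x, lam x ≠ 0) (hbdd : ∃ Λ : ℝ, ∀ x, ‖lam x‖ ≤ Λ)
    (hsum : ∀ z z', InBox (sqLo L a ρ k 1) (sqHi L a M ρ k 1) z → InBox (sqLo L a ρ k 1) (sqHi L a M ρ k 1) z' →
        ∑ r : Fin d → Fin L, lam ((L : ℤ) • z + boxVec L r) = ∑ r : Fin d → Fin L, lam ((L : ℤ) • z' + boxVec L r))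
    (hlan : ∀ x ∈ cube L a M ρ k 1, ∀ x' ∈ cube L a M ρ k 1, blockMap (L ^ 1) x = blockMap (L ^ 1) x' →
        covLap η (1 : Site d → Fin d → ℂˣ) ((cube L a M ρ k 0).indicator
            (covDivB η (1 : Site d → Fin d → ℂˣ) (fun y κ => covDerivFwd η (1 : Site d → Fin d → ℂˣ) κ lam y))) x =
        covLap η (1 : Site d → Fin d → ℂˣ) ((cube L a M ρ k 0).indicator
            (covDivB η (1 : Site d → Fin d → ℂˣ) (fun y κ => covDerivFwd η (1 : Site d → Fin d → ℂˣ) κ lam y))) x')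
    (hSC : ∀ φ : Site d → Fin d → ℂ,
        IsLandau138 L 1 η ((cubeFam false L a M ρ k) 0) ((cubeLamS L a M ρ k) 1) (1 : Site d → Fin d → ℂˣ) φ →
        (∀ (y : Site d) (τ : Fin d), (∀ j, j ≤ 1 → ¬ SideTouches ((cubeFam false L a M ρ k) j) y τ) → φ y τ = 0) →
        msup L 1 η (-(1 : ℝ)) (fun j (b : Site d × Fin d) => SideTouches ((cubeFam false L a M ρ k) j) b.1 b.2) (fun b => φ b.1 b.2)
          ≤ B₀ * (bondNorm L 1 η (-(3 : ℝ)) (cubeFam false L a M ρ k) (fun x μ => Jcur η (1 : Site d → Fin d → ℂˣ) φ μ x)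
            + wsup 1 (fun p : {p : ℕ × (Site d × Fin d) // p.1 ≤ 1 ∧ (p.2 ∈ (cubeLamB L a M ρ k) 1 p.1 ∨ (p.1 = 0 ∧ CrossB ((cubeFam false L a M ρ k) 0) p.2))} =>
                linCovIter L (1 : Site d → Fin d → ℂˣ) (iEta η φ) p.1.1 p.1.2.1 p.1.2.2))
            + Bbd * msup L 1 η (-(1 : ℝ)) (fun j (b : Site d × Fin d) => j = 0 ∧ SideTouches ((cubeFam false L a M ρ k) 0) b.1 b.2 ∧
                ¬ BondTouches ((cubeFam false L a M ρ k) 0) b.1 b.2) (fun b => φ b.1 b.2) ∧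
        msup L 1 η (-(2 : ℝ)) (fun j (t : Fin d × Fin d × Site d) => SideTouches ((cubeFam false L a M ρ k) j) t.2.2 t.2.1)
            (fun t => covDerivFwd η (1 : Site d → Fin d → ℂˣ) t.1 (fun z => φ z t.2.1) t.2.2)
          ≤ B₀ * (bondNorm L 1 η (-(3 : ℝ)) (cubeFam false L a M ρ k) (fun x μ => Jcur η (1 : Site d → Fin d → ℂˣ) φ μ x)
            + wsup 1 (fun p : {p : ℕ × (Site d × Fin d) // p.1 ≤ 1 ∧ (p.2 ∈ (cubeLamB L a M ρ k) 1 p.1 ∨ (p.1 = 0 ∧ CrossB ((cubeFam false L a M ρ k) 0) p.2))} =>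
                linCovIter L (1 : Site d → Fin d → ℂˣ) (iEta η φ) p.1.1 p.1.2.1 p.1.2.2))
            + Bbd * msup L 1 η (-(1 : ℝ)) (fun j (b : Site d × Fin d) => j = 0 ∧ SideTouches ((cubeFam false L a M ρ k) 0) b.1 b.2 ∧
                ¬ BondTouches ((cubeFam false L a M ρ k) 0) b.1 b.2) (fun b => φ b.1 b.2)) : False := by
  classical
  obtain ⟨Λ, hΛ⟩ := hbdd
  have hΛ0 : 0 ≤ Λ := (norm_nonneg _).trans (hΛ a)
  have hηne : η ≠ 0 := hη.ne'
  have hΩ0 : cubeFam false L a M ρ k 0 = cube L a M ρ k 0 := cubeFam_false_zero L a M ρ k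
  have hΩ1 : cubeFam false L a M ρ k 1 = cube L a M ρ k 1 := cubeFam_of_pos false L a M ρ le_rfl hk
  have h10 : cube L a M ρ k 1 ⊆ cube L a M ρ k 0 := cube_succ_subset (by omega)
  have hcollar : ∀ x ∈ cube L a M ρ k 1, ∀ μ : Fin d, x + e μ ∈ cube L a M ρ k 0 ∧ x - e μ ∈ cube L a M ρ k 0 := by
    intro x hx μ
    have hb : ∀ i, |(e μ : Site d) i| ≤ ((ρ * L ^ 0 : ℕ) : ℤ) := by
      intro i
      rw [pow_zero, mul_one]
      change |(Pi.single μ (1 : ℤ) : Fin d → ℤ) i| ≤ (ρ : ℤ)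
      rw [Pi.single_apply]
      split_ifs
      · simp only [abs_one]; exact_mod_cast hρ
      · simp
    have hb' : ∀ i, |(-(e μ) : Site d) i| ≤ ((ρ * L ^ 0 : ℕ) : ℤ) := fun i => by
      rw [Pi.neg_apply, abs_neg]; exact hb i
    exact ⟨add_mem_cube_of_mem_succ (j := 0) (by omega) hx hb,
      by rw [sub_eq_add_neg]; exact add_mem_cube_of_mem_succ (j := 0) (by omega) hx hb'⟩
  -- the field `φ = ∂λ`
  set φ : Site d → Fin d → ℂ := fun y κ => covDerivFwd η (1 : Site d → Fin d → ℂˣ) κ lam y with hφdef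
  have hφ : ∀ y κ, φ y κ = η⁻¹ • (lam (y + e κ) - lam y) := fun y κ => covDerivFwd_flat_apply η κ lam y
  have hφ0 : ∀ y τ, y ∉ cube L a M ρ k 1 → y + e τ ∉ cube L a M ρ k 1 → φ y τ = 0 := by
    intro y τ hy hy'
    rw [hφ, hsupp _ hy, hsupp _ hy', sub_zero, smul_zero]
  have hφbd : ∀ y κ, ‖φ y κ‖ ≤ η⁻¹ * (Λ + Λ) := fun y κ => B8Ineq159FlatMaps.norm_covDerivFwd_flat_le hη hΛ κ y
  -- (1.38) in multiplier form: free on `Λ₀ = □₀ ∖ □₁`, block-constant on `□₁`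
  set H : Site d → ℂ := fun x => covLap η (1 : Site d → Fin d → ℂˣ) ((cube L a M ρ k 0).indicator
    (covDivB η (1 : Site d → Fin d → ℂˣ) φ)) x with hHdef
  have hLan : IsLandau138 L 1 η ((cubeFam false L a M ρ k) 0) ((cubeLamS L a M ρ k) 1) (1 : Site d → Fin d → ℂˣ) φ := by
    refine ⟨fun j y => if j = 0 then H y else (((L : ℝ) ^ d) • H (((L : ℤ) ^ 1) • y)), ?_⟩
    intro x hx
    rw [hΩ0] at hx ⊢
    rw [QT_flat_apply, Finset.sum_range_succ, Finset.sum_range_succ, Finset.sum_range_zero, zero_add, pow_zero, pow_zero,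
      blockMap_one, one_smul, pow_one (((L : ℝ) ^ d)⁻¹)]
    have hΛ0 : (cubeLamS L a M ρ k) 1 0 = cubeLam L a M ρ k 0 := cubeLamS_of_lt L a M ρ k zero_lt_one
    have hΛ1 : (cubeLamS L a M ρ k) 1 1 = {z | InBox (sqLo L a ρ k 1) (sqHi L a M ρ k 1) z} := cubeLamS_self L a M ρ k 1
    rw [hΛ0, hΛ1]
    by_cases hx1 : x ∈ cube L a M ρ k 1
    · have hx0 : x ∉ cubeLam L a M ρ k 0 := fun h => ((mem_cubeLam_zero_iff hL a M ρ hk x).1 h).2 hx1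
      obtain ⟨z, hz, hu⟩ := (mem_cube_iff hL).1 hx1
      have hzx : blockMap (L ^ 1) x = z := (under_iff_blockMap_eq hL 1 z x).1 hu
      have hbm : blockMap (L ^ 1) x ∈ {z | InBox (sqLo L a ρ k 1) (sqHi L a M ρ k 1) z} := by rw [hzx]; exact hz
      rw [Set.indicator_of_notMem hx0, Set.indicator_of_mem hbm, zero_add, if_neg one_ne_zero, smul_smul,
        inv_mul_cancel₀ (by positivity), one_smul]
      have hbase : ((L : ℤ) ^ 1) • blockMap (L ^ 1) x ∈ cube L a M ρ k 1 := by
        rw [hzx]; exact (smul_mem_cube_iff hL a M ρ k 1 z).2 hz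
      have hblk : blockMap (L ^ 1) x = blockMap (L ^ 1) (((L : ℤ) ^ 1) • blockMap (L ^ 1) x) := by
        rw [hzx, blockMap_smul_self hL z]
      exact hlan x hx1 _ hbase hblk
    · have hx0 : x ∈ cubeLam L a M ρ k 0 := (mem_cubeLam_zero_iff hL a M ρ hk x).2 ⟨hx, hx1⟩
      have hbm : blockMap (L ^ 1) x ∉ {z | InBox (sqLo L a ρ k 1) (sqHi L a M ρ k 1) z} := by
        intro h
        exact hx1 ((mem_cube_iff hL).2 ⟨_, h, (under_iff_blockMap_eq hL 1 _ x).2 rfl⟩)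
      rw [Set.indicator_of_mem hx0, Set.indicator_of_notMem hbm, smul_zero, add_zero, if_pos rfl]
  -- the support clause
  have hSupp : ∀ (y : Site d) (τ : Fin d), (∀ j, j ≤ 1 → ¬ SideTouches ((cubeFam false L a M ρ k) j) y τ) → φ y τ = 0 := by
    intro y τ hno
    by_contra hne'
    have hbt : BondTouches (cube L a M ρ k 0) y τ := by
      by_contra hnb
      apply hne'
      apply hφ0
      · exact fun h => hnb (Or.inl (h10 h))
      · exact fun h => hnb (Or.inr (h10 h))
    obtain ⟨κ, hκ⟩ : ∃ κ : Fin d, κ ≠ τ := by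
      by_cases h : τ = ⟨0, by omega⟩
      · exact ⟨⟨1, by omega⟩, by rw [h]; simp [Fin.ext_iff]⟩
      · exact ⟨⟨0, by omega⟩, fun h' => h h'.symm⟩
    exact hno 0 (Nat.zero_le 1) (by rw [hΩ0]; exact sideTouches_of_bondTouches hκ hbt)
  obtain ⟨h1, -⟩ := hSC φ hLan hSupp
  -- the three right-hand terms vanish
  have hP : plaqCovDeriv η (1 : Site d → Fin d → ℂˣ) φ = fun _ _ _ => (0 : ℂ) := by
    funext μ ν x
    rw [plaqCovDeriv_eq_covDerivFwd, covDerivFwd_flat_apply, covDerivFwd_flat_apply]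
    simp only [hφ, add_right_comm x (e ν) (e μ), smul_sub]
    abel
  have hJ0 : (fun x μ => Jcur η (1 : Site d → Fin d → ℂˣ) φ μ x) = 0 := by
    funext x μ
    rw [B8Eq155JBound.Jcur_def, hP]
    simp [pdiv, B8Eq138LandauZd.covDeriv_zero_fun]
  have hηC : (η : ℂ) ≠ 0 := Complex.ofReal_ne_zero.2 hηne
  have hiEta : ∀ (w : Site d) (τ : Fin d), iEta η φ w τ = Complex.I * (lam (w + e τ) - lam w) := by
    intro w τ
    simp only [B8Eq146AExpansion.iEta_def, hφ, Complex.real_smul, smul_eq_mul]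
    push_cast
    rw [mul_assoc, ← mul_assoc (η : ℂ), mul_inv_cancel₀ hηC, one_mul]
  have htel : ∀ (p : Site d) (τ : Fin d),
      ∑ i ∈ Finset.range L, iEta η φ (p + (i : ℤ) • e τ) τ = Complex.I * (lam (p + (L : ℤ) • e τ) - lam p) := by
    intro p τ
    have hshift : ∀ i : ℕ, p + (i : ℤ) • e τ + e τ = p + ((i + 1 : ℕ) : ℤ) • e τ := by
      intro i; push_cast; rw [add_smul, one_smul, add_assoc]
    simp_rw [hiEta, hshift]
    have hsub := Finset.sum_range_sub (fun i : ℕ => lam (p + (i : ℤ) • e τ)) L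
    rw [← Finset.mul_sum, hsub]
    simp
  have hdata : ∀ p : {p : ℕ × (Site d × Fin d) // p.1 ≤ 1 ∧ (p.2 ∈ (cubeLamB L a M ρ k) 1 p.1 ∨
      (p.1 = 0 ∧ CrossB ((cubeFam false L a M ρ k) 0) p.2))},
      linCovIter L (1 : Site d → Fin d → ℂˣ) (iEta η φ) p.1.1 p.1.2.1 p.1.2.2 = 0 := by
    rintro ⟨⟨j, y, τ⟩, hj, hmem⟩
    simp only at hj hmem ⊢
    rcases Nat.le_one_iff_eq_zero_or_eq_one.mp hj with rfl | rfl
    · -- level 0: the datum is `iη·φ` itself, on bonds both of whose ends avoid `□₁`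
      rw [linCovIter_zero]
      suffices hφz : φ y τ = 0 by simp [B8Eq146AExpansion.iEta_def, hφz]
      rcases hmem with hc | ⟨-, hcross⟩
      · rcases hc.2 with ⟨hy, hy'⟩ | ⟨j', hj', -⟩ | ⟨j', hj', -⟩
        · rw [cubeLamS_of_lt L a M ρ k zero_lt_one] at hy hy'
          exact hφ0 y τ ((mem_cubeLam_zero_iff hL a M ρ hk y).1 hy).2 ((mem_cubeLam_zero_iff hL a M ρ hk _).1 hy').2
        · omega
        · omega
      · obtain ⟨-, hnot⟩ := hcross
        rw [hΩ0] at hnot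
        refine hφ0 y τ (fun h => hnot ⟨h10 h, (hcollar y h τ).1⟩) (fun h => hnot ⟨?_, h10 h⟩)
        have := (hcollar _ h τ).2
        rwa [add_sub_cancel_right] at this
    · -- level 1: the datum is `i·L^{-d}·(Σ_{B(c₊)} λ − Σ_{B(c₋)} λ) = 0` by the equal block sums
      rcases hmem with hc | ⟨h10', -⟩
      swap; · omega
      have hends := cubeLamB_ends_inBox_sq hL a M ρ hk hc
      have hMb : ∀ x κ, ‖iEta η φ x κ‖ ≤ η * (η⁻¹ * (Λ + Λ)) :=
        B8Eq146AExpansion.norm_iEta_le hη.le hφbd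
      show linCovIter L (1 : Site d → Fin d → ℂˣ) (iEta η φ) (0 + 1) y τ = 0
      rw [linCovIter_succ, linCovIter_zero, avgIter_zero,
        linQcov_one_left L hL (iEta η φ) (mul_nonneg hη.le (mul_nonneg (inv_nonneg.2 hη.le) (add_nonneg hΛ0 hΛ0))) hMb]
      simp only [linQ, asum_seg_natCast, htel]
      have hpt : ∀ r : Fin d → Fin L, (L : ℤ) • y + boxVec L r + (L : ℤ) • e τ = (L : ℤ) • (y + e τ) + boxVec L r := by
        intro r; rw [smul_add]; abel
      simp_rw [hpt]
      calc ∑ r : Fin d → Fin L, (((L : ℝ) ^ d)⁻¹ • (Complex.I * (lam ((L : ℤ) • (y + e τ) + boxVec L r) - lam ((L : ℤ) • y + boxVec L r))))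
          = (((L : ℝ) ^ d)⁻¹ : ℝ) • (Complex.I * (∑ r : Fin d → Fin L, lam ((L : ℤ) • (y + e τ) + boxVec L r) -
              ∑ r : Fin d → Fin L, lam ((L : ℤ) • y + boxVec L r))) := by
            simp only [mul_sub, smul_sub, Finset.sum_sub_distrib, Finset.mul_sum, Finset.smul_sum]
        _ = 0 := by rw [hsum (y + e τ) y hends.2 hends.1, sub_self, mul_zero, smul_zero]
  have hW : wsup 1 (fun p : {p : ℕ × (Site d × Fin d) // p.1 ≤ 1 ∧ (p.2 ∈ (cubeLamB L a M ρ k) 1 p.1 ∨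
      (p.1 = 0 ∧ CrossB ((cubeFam false L a M ρ k) 0) p.2))} =>
        linCovIter L (1 : Site d → Fin d → ℂˣ) (iEta η φ) p.1.1 p.1.2.1 p.1.2.2) = 0 :=
    le_antisymm (wsup_le (fun p => by rw [hdata p, norm_zero, mul_zero]) le_rfl) (wsup_nonneg zero_le_one _)
  have hO : msup L 1 η (-(1 : ℝ)) (fun j (b : Site d × Fin d) => j = 0 ∧ SideTouches ((cubeFam false L a M ρ k) 0) b.1 b.2 ∧
      ¬ BondTouches ((cubeFam false L a M ρ k) 0) b.1 b.2) (fun b => φ b.1 b.2) = 0 := by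
    refine le_antisymm (msup_le le_rfl fun j _ b hb => ?_) (msup_nonneg L 1 hη.le _ _ _)
    obtain ⟨-, -, hnb⟩ := hb
    rw [hΩ0] at hnb
    have : φ b.1 b.2 = 0 := hφ0 b.1 b.2 (fun h => hnb (Or.inl (h10 h))) (fun h => hnb (Or.inr (h10 h)))
    rw [this, norm_zero, mul_zero]
  rw [hJ0, bondNorm_zero, hW, hO, mul_zero, zero_add, add_zero, mul_zero] at h1
  -- but the left side is positive: a bond where `φ ≠ 0`
  obtain ⟨x₁, hx₁⟩ := hne
  set τ₀ : Fin d := ⟨0, by omega⟩ with hτ₀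
  have hP' : ∃ t : ℕ, lam (x₁ + ((t + 1 : ℕ) : ℤ) • e τ₀) = 0 := by
    by_contra hall
    push Not at hall
    have hmem : ∀ t : ℕ, x₁ + ((t + 1 : ℕ) : ℤ) • e τ₀ ∈ cube L a M ρ k 1 := fun t => by
      by_contra h; exact hall t (hsupp _ h)
    have hinj : Function.Injective (fun t : ℕ => x₁ + ((t + 1 : ℕ) : ℤ) • e τ₀) := by
      intro t t' h
      have := congrFun h τ₀
      simp only [Pi.add_apply, Pi.smul_apply, smul_eq_mul, e, Pi.single_eq_same, mul_one, add_right_inj] at this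
      omega
    have hfin : (cube L a M ρ k 1).Finite := inBox_finite _ _
    exact (Set.infinite_range_of_injective hinj) (hfin.subset (by rintro _ ⟨t, rfl⟩; exact hmem t))
  obtain ⟨t₀, ht₀, hmin⟩ : ∃ t₀ : ℕ, lam (x₁ + ((t₀ + 1 : ℕ) : ℤ) • e τ₀) = 0 ∧ lam (x₁ + (t₀ : ℤ) • e τ₀) ≠ 0 := by
    refine ⟨Nat.find hP', Nat.find_spec hP', ?_⟩
    rcases Nat.eq_zero_or_pos (Nat.find hP') with h0 | hpos
    · rw [h0]; simpa using hx₁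
    · have := Nat.find_min hP' (m := Nat.find hP' - 1) (by omega)
      rwa [show Nat.find hP' - 1 + 1 = Nat.find hP' by omega] at this
  set y₀ : Site d := x₁ + (t₀ : ℤ) • e τ₀ with hy₀
  have hy₀e : y₀ + e τ₀ = x₁ + ((t₀ + 1 : ℕ) : ℤ) • e τ₀ := by
    rw [hy₀]; push_cast; rw [add_smul, one_smul, add_assoc]
  have hφy₀ : φ y₀ τ₀ ≠ 0 := by
    rw [hφ, hy₀e, ht₀, zero_sub]
    exact smul_ne_zero (inv_ne_zero hηne) (neg_ne_zero.2 hmin)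
  have hy₀mem : y₀ ∈ cube L a M ρ k 1 := by
    by_contra h; exact hmin (hsupp _ h)
  have hκτ : (⟨1, by omega⟩ : Fin d) ≠ τ₀ := by rw [hτ₀]; simp [Fin.ext_iff]
  have hside : SideTouches ((cubeFam false L a M ρ k) 0) y₀ τ₀ := by
    rw [hΩ0]; exact sideTouches_of_bondTouches hκτ (Or.inl (h10 hy₀mem))
  have hBdd : Bdd L 1 η (-(1 : ℝ)) (fun j (b : Site d × Fin d) => SideTouches ((cubeFam false L a M ρ k) j) b.1 b.2)
      (fun b => φ b.1 b.2) := by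
    refine ⟨((L : ℝ) * η) * (η⁻¹ * (Λ + Λ)), fun j hj b _ => ?_⟩
    have hw : weight L η (-(1 : ℝ)) j = (L : ℝ) ^ j * η := by
      simp only [weight, neg_neg, Real.rpow_one]
    have hwle : weight L η (-(1 : ℝ)) j ≤ (L : ℝ) * η := by
      rw [hw]
      have : (L : ℝ) ^ j ≤ (L : ℝ) ^ 1 := pow_le_pow_right₀ (by exact_mod_cast hL) hj
      rw [pow_one] at this
      exact mul_le_mul_of_nonneg_right this hη.le
    exact mul_le_mul hwle (hφbd b.1 b.2) (norm_nonneg _) (by positivity)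
  have hle := weight_mul_norm_le_msup hBdd (j := 0) (Nat.zero_le 1) (i := (y₀, τ₀)) hside
  have hw0 : weight L η (-(1 : ℝ)) 0 = η := by simp [weight]
  rw [hw0] at hle
  have hpos : 0 < η * ‖φ y₀ τ₀‖ := mul_pos hη (norm_pos_iff.2 hφy₀)
  linarith



/-! ## §4 The certificate: the two-line β clause at `m = 1` is false at every cube member with `k ≥ 1` -/

/-- ★ **`SC2` AT `m = 1` IS FALSE AT EVERY CUBE MEMBER WITH `k ≥ 1`** (`d ≥ 2`, `L ≥ 1`, `η > 0`, `ρ ≥ 1`; every `B₀`, `B_∂`): the negation of the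
β-edition scalar flat two-line (1.59) clause of Theorem 4's frame (`B8Prop6CubeMemberScalarBdryBeta` :150–166 ∕ `…Printed`) at truncation `1`, verbatim.
[cite: Balaban1985RegularSpaces, (1.59) p.86, Thm 4 p.88, (1.31) p.82, (1.131) p.99; Balaban1985BackgroundPropagators, Thm 3.3 p.399; Balaban1984PropagatorsII, (2.3) p.224] -/
theorem not_flat159β_two_cubeMember_one (hd2 : 2 ≤ d) {L : ℕ} (hL : 1 ≤ L) {η : ℝ} (hη : 0 < η) (a : Site d) (M : ℕ)
    {ρ : ℕ} (hρ : 1 ≤ ρ) {k : ℕ} (hk : 1 ≤ k) (B₀ Bbd : ℝ) :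
    ¬ (∀ φ : Site d → Fin d → ℂ,
        IsLandau138 L 1 η ((cubeFam false L a M ρ k) 0) ((cubeLamS L a M ρ k) 1) (1 : Site d → Fin d → ℂˣ) φ →
        (∀ (y : Site d) (τ : Fin d), (∀ j, j ≤ 1 → ¬ SideTouches ((cubeFam false L a M ρ k) j) y τ) → φ y τ = 0) →
        msup L 1 η (-(1 : ℝ)) (fun j (b : Site d × Fin d) => SideTouches ((cubeFam false L a M ρ k) j) b.1 b.2) (fun b => φ b.1 b.2)
          ≤ B₀ * (bondNorm L 1 η (-(3 : ℝ)) (cubeFam false L a M ρ k) (fun x μ => Jcur η (1 : Site d → Fin d → ℂˣ) φ μ x)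
            + wsup 1 (fun p : {p : ℕ × (Site d × Fin d) // p.1 ≤ 1 ∧ (p.2 ∈ (cubeLamB L a M ρ k) 1 p.1 ∨ (p.1 = 0 ∧ CrossB ((cubeFam false L a M ρ k) 0) p.2))} =>
                linCovIter L (1 : Site d → Fin d → ℂˣ) (iEta η φ) p.1.1 p.1.2.1 p.1.2.2))
            + Bbd * msup L 1 η (-(1 : ℝ)) (fun j (b : Site d × Fin d) => j = 0 ∧ SideTouches ((cubeFam false L a M ρ k) 0) b.1 b.2 ∧
                ¬ BondTouches ((cubeFam false L a M ρ k) 0) b.1 b.2) (fun b => φ b.1 b.2) ∧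
        msup L 1 η (-(2 : ℝ)) (fun j (t : Fin d × Fin d × Site d) => SideTouches ((cubeFam false L a M ρ k) j) t.2.2 t.2.1)
            (fun t => covDerivFwd η (1 : Site d → Fin d → ℂˣ) t.1 (fun z => φ z t.2.1) t.2.2)
          ≤ B₀ * (bondNorm L 1 η (-(3 : ℝ)) (cubeFam false L a M ρ k) (fun x μ => Jcur η (1 : Site d → Fin d → ℂˣ) φ μ x)
            + wsup 1 (fun p : {p : ℕ × (Site d × Fin d) // p.1 ≤ 1 ∧ (p.2 ∈ (cubeLamB L a M ρ k) 1 p.1 ∨ (p.1 = 0 ∧ CrossB ((cubeFam false L a M ρ k) 0) p.2))} =>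
                linCovIter L (1 : Site d → Fin d → ℂˣ) (iEta η φ) p.1.1 p.1.2.1 p.1.2.2))
            + Bbd * msup L 1 η (-(1 : ℝ)) (fun j (b : Site d × Fin d) => j = 0 ∧ SideTouches ((cubeFam false L a M ρ k) 0) b.1 b.2 ∧
                ¬ BondTouches ((cubeFam false L a M ρ k) 0) b.1 b.2) (fun b => φ b.1 b.2)) := by
  intro hSC
  obtain ⟨lam, hsupp, hne, hbdd, hsum, hlan⟩ := exists_shellMode hL η a M hρ k
  exact false_of_shellMode hd2 hL hη a M hρ hk B₀ Bbd hsupp hne hbdd hsum hlan hSC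

/-- ★ **THE `∀ m ≤ k` FORM CARRIED BY THE FLAT p6 LETTER IS FALSE AT EVERY CUBE MEMBER WITH `k ≥ 1`** (instance `m = 1`).
[cite: Balaban1985RegularSpaces, (1.59) p.86, Thm 4 p.88, Prop. 6 p.99, (1.131) p.99; Balaban1985BackgroundPropagators, Thm 3.3 p.399] -/
theorem not_flat159β_two_cubeMember (hd2 : 2 ≤ d) {L : ℕ} (hL : 1 ≤ L) {η : ℝ} (hη : 0 < η) (a : Site d) (M : ℕ)
    {ρ : ℕ} (hρ : 1 ≤ ρ) {k : ℕ} (hk : 1 ≤ k) (B₀ Bbd : ℝ) :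
    ¬ (∀ m, 1 ≤ m → m ≤ k → ∀ φ : Site d → Fin d → ℂ,
        IsLandau138 L m η ((cubeFam false L a M ρ k) 0) ((cubeLamS L a M ρ k) m) (1 : Site d → Fin d → ℂˣ) φ →
        (∀ (y : Site d) (τ : Fin d), (∀ j, j ≤ m → ¬ SideTouches ((cubeFam false L a M ρ k) j) y τ) → φ y τ = 0) →
        msup L m η (-(1 : ℝ)) (fun j (b : Site d × Fin d) => SideTouches ((cubeFam false L a M ρ k) j) b.1 b.2) (fun b => φ b.1 b.2)
          ≤ B₀ * (bondNorm L m η (-(3 : ℝ)) (cubeFam false L a M ρ k) (fun x μ => Jcur η (1 : Site d → Fin d → ℂˣ) φ μ x)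
            + wsup 1 (fun p : {p : ℕ × (Site d × Fin d) // p.1 ≤ m ∧ (p.2 ∈ (cubeLamB L a M ρ k) m p.1 ∨ (p.1 = 0 ∧ CrossB ((cubeFam false L a M ρ k) 0) p.2))} =>
                linCovIter L (1 : Site d → Fin d → ℂˣ) (iEta η φ) p.1.1 p.1.2.1 p.1.2.2))
            + Bbd * msup L m η (-(1 : ℝ)) (fun j (b : Site d × Fin d) => j = 0 ∧ SideTouches ((cubeFam false L a M ρ k) 0) b.1 b.2 ∧
                ¬ BondTouches ((cubeFam false L a M ρ k) 0) b.1 b.2) (fun b => φ b.1 b.2) ∧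
        msup L m η (-(2 : ℝ)) (fun j (t : Fin d × Fin d × Site d) => SideTouches ((cubeFam false L a M ρ k) j) t.2.2 t.2.1)
            (fun t => covDerivFwd η (1 : Site d → Fin d → ℂˣ) t.1 (fun z => φ z t.2.1) t.2.2)
          ≤ B₀ * (bondNorm L m η (-(3 : ℝ)) (cubeFam false L a M ρ k) (fun x μ => Jcur η (1 : Site d → Fin d → ℂˣ) φ μ x)
            + wsup 1 (fun p : {p : ℕ × (Site d × Fin d) // p.1 ≤ m ∧ (p.2 ∈ (cubeLamB L a M ρ k) m p.1 ∨ (p.1 = 0 ∧ CrossB ((cubeFam false L a M ρ k) 0) p.2))} =>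
                linCovIter L (1 : Site d → Fin d → ℂˣ) (iEta η φ) p.1.1 p.1.2.1 p.1.2.2))
            + Bbd * msup L m η (-(1 : ℝ)) (fun j (b : Site d × Fin d) => j = 0 ∧ SideTouches ((cubeFam false L a M ρ k) 0) b.1 b.2 ∧
                ¬ BondTouches ((cubeFam false L a M ρ k) 0) b.1 b.2) (fun b => φ b.1 b.2)) := by
  intro hSC
  exact not_flat159β_two_cubeMember_one hd2 hL hη a M hρ hk B₀ Bbd (hSC 1 le_rfl hk)


/-- ★★ **THE `SC2` HYPOTHESIS OF `gaugedBoundB8_cubeMember_scalar_bdryβ_printed` IS UNINHABITED AT EVERY `Node00.CubeB8` CUBE** (`d ≥ 2`, `L ≥ 1`,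
`η > 0`, every `B₀`, `B_∂`; `c.one_le_k`, `c.L_le_ρ`): that theorem — and every theorem taking the β-edition two-line clause at all truncations as a
hypothesis — is vacuous as typed. [cite: Balaban1985RegularSpaces, Prop. 6 p.99, (1.59) p.86, Thm 4 p.88, (1.31) p.82, (1.131) p.99; Balaban1985BackgroundPropagators, Thm 3.3 p.399] -/
theorem sc2_uninhabited_cubeB8 (hd2 : 2 ≤ d) {L : ℕ} (hL : 1 ≤ L) {η : ℝ} (hη : 0 < η) {K : ℕ} {Ω : ℕ → Set (Site d)}
    (c : Node00.CubeB8 d L K Ω) (B₀ Bbd : ℝ) :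
    ¬ (∀ m, 1 ≤ m → m ≤ c.k → ∀ φ : Site d → Fin d → ℂ,
        IsLandau138 L m η ((cubeFam false L c.a c.M c.ρ c.k) 0) ((cubeLamS L c.a c.M c.ρ c.k) m) (1 : Site d → Fin d → ℂˣ) φ →
        (∀ (y : Site d) (τ : Fin d), (∀ j, j ≤ m → ¬ SideTouches ((cubeFam false L c.a c.M c.ρ c.k) j) y τ) → φ y τ = 0) →
        msup L m η (-(1 : ℝ)) (fun j (b : Site d × Fin d) => SideTouches ((cubeFam false L c.a c.M c.ρ c.k) j) b.1 b.2) (fun b => φ b.1 b.2)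
          ≤ B₀ * (bondNorm L m η (-(3 : ℝ)) (cubeFam false L c.a c.M c.ρ c.k) (fun x μ => Jcur η (1 : Site d → Fin d → ℂˣ) φ μ x)
            + wsup 1 (fun p : {p : ℕ × (Site d × Fin d) // p.1 ≤ m ∧ (p.2 ∈ (cubeLamB L c.a c.M c.ρ c.k) m p.1 ∨ (p.1 = 0 ∧ CrossB ((cubeFam false L c.a c.M c.ρ c.k) 0) p.2))} =>
                linCovIter L (1 : Site d → Fin d → ℂˣ) (iEta η φ) p.1.1 p.1.2.1 p.1.2.2))
            + Bbd * msup L m η (-(1 : ℝ)) (fun j (b : Site d × Fin d) => j = 0 ∧ SideTouches ((cubeFam false L c.a c.M c.ρ c.k) 0) b.1 b.2 ∧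
                ¬ BondTouches ((cubeFam false L c.a c.M c.ρ c.k) 0) b.1 b.2) (fun b => φ b.1 b.2) ∧
        msup L m η (-(2 : ℝ)) (fun j (t : Fin d × Fin d × Site d) => SideTouches ((cubeFam false L c.a c.M c.ρ c.k) j) t.2.2 t.2.1)
            (fun t => covDerivFwd η (1 : Site d → Fin d → ℂˣ) t.1 (fun z => φ z t.2.1) t.2.2)
          ≤ B₀ * (bondNorm L m η (-(3 : ℝ)) (cubeFam false L c.a c.M c.ρ c.k) (fun x μ => Jcur η (1 : Site d → Fin d → ℂˣ) φ μ x)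
            + wsup 1 (fun p : {p : ℕ × (Site d × Fin d) // p.1 ≤ m ∧ (p.2 ∈ (cubeLamB L c.a c.M c.ρ c.k) m p.1 ∨ (p.1 = 0 ∧ CrossB ((cubeFam false L c.a c.M c.ρ c.k) 0) p.2))} =>
                linCovIter L (1 : Site d → Fin d → ℂˣ) (iEta η φ) p.1.1 p.1.2.1 p.1.2.2))
            + Bbd * msup L m η (-(1 : ℝ)) (fun j (b : Site d × Fin d) => j = 0 ∧ SideTouches ((cubeFam false L c.a c.M c.ρ c.k) 0) b.1 b.2 ∧
                ¬ BondTouches ((cubeFam false L c.a c.M c.ρ c.k) 0) b.1 b.2) (fun b => φ b.1 b.2)) :=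
  not_flat159β_two_cubeMember hd2 hL hη c.a c.M (hL.trans c.L_le_ρ) c.one_le_k B₀ Bbd

#print axioms sc2_uninhabited_cubeB8

end Literature.MathematicalPhysics.QuantumFieldTheory.Balaban1983to89.B8Ineq159FlatShellModeVacuity

end
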